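import Mathlib.Analysis.Calculus.Deriv.Slope
import Summits.Ventures.LatticeQCDFlow.Scaling.SwapLadderRoundTripOptimum
import Summits.Ventures.LatticeQCDFlow.Scaling.SwapLadderIndexTauInt

/-!
HONEST FRAMING: exact (Metropolis-corrected) sampling algorithms for lattice gauge theory; figures
of merit are autocorrelation/cost numbers at stated couplings and volumes; no continuum-physics
claim.

# SwapLadderIndexTauIntTuning — THE EQUAL-ACCEPTANCE LADDER IS NOT OPTIMAL FOR THE REPLICA-INDEX `τ_int` ONCE
# `K ≥ 3`: SHIFTING STIFFNESS FROM THE SECOND PAIR TO THE OUTERMOST ONE LOWERS THE MODEL `τ_int` OF THE INDEX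
# WHILE IT LENGTHENS THE MODEL ROUND TRIP — the two figures of merit pull the ladder in different directions
# (row 22 `su3-ptbc`, GEN-7, ours; sequel of `SwapLadderIndexTauInt` + `SwapLadderRoundTripOptimum`)

Venture `LatticeQCDFlow` (cell pub-lqcd), topic `Scaling`; FANOUT row 22 (`su3-ptbc`).  NEW WORK of the cell over
GEN-6's `SwapLadderIndexTauInt` (**`tauInt_levelObs_profile`**: for EVERY acceptance profile the replica index of the
idealised swap ladder has `τ_int = (6/(K(K+1)(K+2)))·Σ_{j<K} w_j²/a_j − 1/2`, `w_j = (j+1)(K−j)`) and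
`SwapLadderRoundTripOptimum` (`gaussInvAcc ℓ = 1/erfc(ℓ/(2√2))`, `hasDerivAt_gaussInvAcc`, `gaussNegLogDeriv_pos`,
`strictConvexOn_gaussInvAcc` ⇒ `mul_gaussInvAcc_div_lt_sum`: the uniform ladder is the UNIQUE minimiser of the model
round trip `2(K+1)·Σ_i 1/gaussAcc(gap_i)`), with GEN-4's ladder vocabulary (`ladderGap`, `uniformLadder`) and
Mathlib's one-sided slope limit `HasDerivAt.tendsto_slope_zero_right`.  Nothing is cited as a fact; no `native_decide`.

THE POINT (model statements).  In the Gaussian swap model a `K`-interval ladder `g` with gaps `ℓ_j` has pair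
acceptances `a_j = gaussAcc ℓ_j`; its model round trip is `2(K+1)·Σ_j gaussInvAcc ℓ_j` (profile-SYMMETRIC in the
pairs) but its model index `τ_int` is `(6/(K(K+1)(K+2)))·indexCost − 1/2` with
**`indexCost K g = Σ_{j<K} w_j²·gaussInvAcc ℓ_j`**, whose passage weights `w_j² = (j+1)²(K−j)²` are LARGEST IN THE
MIDDLE of the ladder.  For `K ≤ 2` the weights are equal (`indexCost 2 g = 4·Σ_j gaussInvAcc ℓ_j`), so the uniform
ladder minimises both; for `K ≥ 3` they are not (`w_0 = K < w_1 = 2(K−1)`), and the first-order computation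
`d/dδ [w_0²·G(c+δ) + w_1²·G(c−δ)]_{δ=0} = (w_0² − w_1²)·G′(c) < 0` (`G = gaussInvAcc`, `G′ > 0`) shows that moving a
little stiffness `δ` from pair `1` to the outermost pair `0` (end pair WIDER / lower acceptance, its neighbour
TIGHTER / higher acceptance, same endpoints, same `K`) strictly LOWERS `indexCost`, while — `G` being strictly
convex — it strictly RAISES `Σ_j G(ℓ_j)`, i.e. the round trip.

* §1 `indexCost`; **`model_index_tauInt`** (`τ_int` of (15) `= (6/(K(K+1)(K+2)))·indexCost K g − 1/2` for the
  model profile `ladderProfile g`); `indexCost_uniformLadder`; `indexCost_two` (`K = 2`: `= 4·Σ G`).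
* §2 `twoGapFn K c δ = K²·G(c+δ) + (2(K−1))²·G(c−δ)`, `hasDerivAt_twoGapFn_zero`, **`exists_twoGapFn_lt`**
  (`K ≥ 3`, `c > 0` ⇒ some `0 < δ < c` with `twoGapFn K c δ < twoGapFn K c 0`).
* §3 `bumpLadder g₀ Λ K δ` (uniform ladder with `g 1` moved up by `δ`): gaps, endpoints, strict monotonicity for
  `|δ| < Λ/K`; `indexCost_bumpLadder_sub`; `sum_gaussInvAcc_bumpLadder_gt` (round trip strictly longer, `δ ≠ 0`).
* §5 `le_passageWeight` / `passageWeight_le` (`K ≤ w_j ≤ (K+1)²/4`) ⇒ **`sq_mul_sum_le_indexCost`**,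
  **`indexCost_le_mul_sum`**: `K²·ΣG ≤ indexCost ≤ ((K+1)⁴/16)·ΣG` for EVERY ladder — the model index `τ_int + 1/2`
  lies between `3K/((K+1)²(K+2))` and `3(K+1)²/(16K(K+2))` model round trips (flat: `(K²+2K+2)/(10K(K+1))`).
* §4 **`exists_ladder_indexCost_lt_uniform`** — for every `K ≥ 3`, `Λ > 0`, `g₀`: a strictly increasing
  `K`-interval ladder with the same endpoints whose `indexCost` is STRICTLY BELOW the uniform ladder's while its
  `Σ_j gaussInvAcc(gap_j)` is STRICTLY ABOVE; **`model_index_tauInt_lt_uniform`** — the same in the `asympVar` /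
  hitting-time vocabulary of (15) / `SwapLadderRoundTrip`: model `τ_int(index)` smaller AND model round trip longer
  than the equal-acceptance ladder's.

READING for CARD-su3-ptbc §1.6 (value-free): the equal-acceptance rule is the right model target for ROUND TRIPS
(GEN-6, unique optimum) and for the minimax / product criteria (GEN-4/6), but NOT for the integrated autocorrelation
time of the replica index, whose model optimum loosens the end pairs and tightens the middle; which diagnostic a
reproduction reports therefore matters when ladders are compared.  NEAREST PRINTED WORK, NAMED ONLY (nothing
imported or restated): Katzgraber–Trebst–Huse–Troyer, J. Stat. Mech. (2006) P03018 ("feedback-optimized parallel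
tempering"; reviewed in Trebst–Troyer, *Ensemble optimization techniques*, §4) maximise the round-trip CURRENT and get
non-flat swap acceptances from a temperature-dependent diffusivity near a transition — a different mechanism: here the
pair law is homogeneous, the round-trip optimum IS the flat-acceptance ladder (GEN-6), and the non-uniformity comes from
the passage weights of the `τ_int` functional alone.  NOT CLAIMED: the `τ_int`-optimal ladder itself, the size of the
gain (first order only), that either model describes PTBC at the card's points, anything measured.
-/

noncomputable section

open Finset Real Filter Topology
open Literature.Probability.MarkovChains

namespace Summit.Ventures.LatticeQCDFlow.Scaling

/-! ## §1 The model index cost of a ladder -/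

section Cost

variable {K : ℕ}

/-- **The model index cost** `indexCost K g = Σ_{j<K} w_j²·gaussInvAcc(gap_j)`, `w_j = (j+1)(K−j)`. [ours] -/
def indexCost (K : ℕ) (g : ℕ → ℝ) : ℝ :=
  ∑ j ∈ range K, passageWeight K j ^ 2 * gaussInvAcc (ladderGap g j)

/-- **The model `τ_int` of the replica index of a ladder** `g` (idealised walk with the model profile
`a_j = gaussAcc(gap_j)`, `K ≥ 1`): `τ_int = (6/(K(K+1)(K+2)))·indexCost K g − 1/2`. [ours] -/
theorem model_index_tauInt {g : ℕ → ℝ} {p q : ℕ → ℝ} (hK : 1 ≤ K) (hP : IsRowStochastic (bdKernel K p q))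
    (hp : ∀ k, k < K → p k = ladderProfile g k / 2) (hpK : p K = 0) (hq0 : q 0 = 0)
    (hq : ∀ k, 1 ≤ k → k ≤ K → q k = ladderProfile g (k - 1) / 2) :
    asympVar (levelObs K) (unifLaw K) (bdKernel K p q)
        / (2 * piInner (unifLaw K) (centred (unifLaw K) (levelObs K)) (centred (unifLaw K) (levelObs K)))
      = 6 / ((K : ℝ) * (K + 1) * (K + 2)) * indexCost K g - 1 / 2 := by
  rw [tauInt_levelObs_profile (fun k _ => ladderProfile_pos g k) hK hP hp hpK hq0 hq]
  unfold indexCost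
  congr 2
  refine sum_congr rfl fun j _ => ?_
  rw [gaussInvAcc_apply, ladderProfile]
  ring

/-- The uniform ladder: `indexCost = K(K+1)(K+2)(K²+2K+2)/30 · gaussInvAcc(Λ/K)`. [ours] -/
theorem indexCost_uniformLadder (g₀ Λ : ℝ) (K : ℕ) :
    indexCost K (uniformLadder g₀ Λ K)
      = (K : ℝ) * (K + 1) * (K + 2) * ((K : ℝ) ^ 2 + 2 * K + 2) / 30 * gaussInvAcc (Λ / K) := by
  unfold indexCost
  simp only [ladderGap_uniformLadder]
  rw [← sum_mul, sum_passageWeight_sq]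

/-- `K = 2`: both passage weights equal `2`, so `indexCost 2 g = 4·Σ_j gaussInvAcc(gap_j)` — a multiple of the
round-trip functional, minimised by the uniform ladder (`mul_gaussInvAcc_div_le_sum`); the phenomenon below needs
`K ≥ 3`. [ours] -/
theorem indexCost_two (g : ℕ → ℝ) : indexCost 2 g = 4 * ∑ j ∈ range 2, gaussInvAcc (ladderGap g j) := by
  unfold indexCost passageWeight
  simp only [sum_range_succ, sum_range_zero]
  norm_num
  ring

/-- `w_0 = K`. [ours] -/
theorem passageWeight_zero (K : ℕ) : passageWeight K 0 = K := by
  simp [passageWeight]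

/-- `w_1 = 2(K − 1)`. [ours] -/
theorem passageWeight_one (K : ℕ) : passageWeight K 1 = 2 * ((K : ℝ) - 1) := by
  simp only [passageWeight]; push_cast; ring

end Cost

/-! ## §2 The first-order computation on two gaps -/

section TwoGap

/-- `twoGapFn K c δ = K²·G(c+δ) + (2(K−1))²·G(c−δ)`, `G = gaussInvAcc`: the contribution of pairs `0` and `1` to
`indexCost` when stiffness `δ` is moved from pair `1` to pair `0`. [ours] -/
def twoGapFn (K : ℕ) (c δ : ℝ) : ℝ :=
  (K : ℝ) ^ 2 * gaussInvAcc (c + δ) + (2 * ((K : ℝ) - 1)) ^ 2 * gaussInvAcc (c - δ)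

/-- `d/dδ twoGapFn K c δ |_{δ=0} = (K² − 4(K−1)²)·G′(c)`, `G′(c) = gaussInvAcc c · gaussNegLogDeriv c`. [ours] -/
theorem hasDerivAt_twoGapFn_zero (K : ℕ) (c : ℝ) :
    HasDerivAt (twoGapFn K c)
      (((K : ℝ) ^ 2 - (2 * ((K : ℝ) - 1)) ^ 2) * (gaussInvAcc c * gaussNegLogDeriv c)) 0 := by
  have h1 : HasDerivAt (fun δ => gaussInvAcc (c + δ)) (gaussInvAcc c * gaussNegLogDeriv c) 0 :=
    HasDerivAt.comp_const_add c 0 (by rw [add_zero]; exact hasDerivAt_gaussInvAcc c)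
  have h2 : HasDerivAt (fun δ => gaussInvAcc (c - δ)) (-(gaussInvAcc c * gaussNegLogDeriv c)) 0 :=
    HasDerivAt.comp_const_sub c 0 (by rw [sub_zero]; exact hasDerivAt_gaussInvAcc c)
  have h := (h1.const_mul ((K : ℝ) ^ 2)).add (h2.const_mul ((2 * ((K : ℝ) - 1)) ^ 2))
  have e : twoGapFn K c
      = fun δ => (K : ℝ) ^ 2 * gaussInvAcc (c + δ) + (2 * ((K : ℝ) - 1)) ^ 2 * gaussInvAcc (c - δ) := rfl
  rw [e]
  refine h.congr_deriv ?_
  ring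

/-- For `K ≥ 3` the derivative at `0` is negative (`K² < 4(K−1)²`, `G′ > 0`). [ours] -/
theorem twoGapFn_deriv_neg {K : ℕ} (hK : 3 ≤ K) (c : ℝ) :
    ((K : ℝ) ^ 2 - (2 * ((K : ℝ) - 1)) ^ 2) * (gaussInvAcc c * gaussNegLogDeriv c) < 0 := by
  have hK' : (3 : ℝ) ≤ K := by exact_mod_cast hK
  have hw : (K : ℝ) ^ 2 - (2 * ((K : ℝ) - 1)) ^ 2 < 0 := by nlinarith
  exact mul_neg_of_neg_of_pos hw (mul_pos (gaussInvAcc_pos c) (gaussNegLogDeriv_pos c))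

/-- **Some small shift `0 < δ < c` strictly lowers the two-gap contribution** (`K ≥ 3`, `c > 0`): the slope
`(twoGapFn K c δ − twoGapFn K c 0)/δ` tends to the negative derivative as `δ ↓ 0`. [ours] -/
theorem exists_twoGapFn_lt {K : ℕ} (hK : 3 ≤ K) {c : ℝ} (hc : 0 < c) :
    ∃ δ : ℝ, 0 < δ ∧ δ < c ∧ twoGapFn K c δ < twoGapFn K c 0 := by
  have hd := hasDerivAt_twoGapFn_zero K c
  have hslope := hd.tendsto_slope_zero_right
  have hneg := twoGapFn_deriv_neg hK c
  have hev : ∀ᶠ t in 𝓝[>] (0 : ℝ), t⁻¹ • (twoGapFn K c (0 + t) - twoGapFn K c 0) < 0 :=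
    hslope.eventually_lt_const hneg
  have hpos : ∀ᶠ t in 𝓝[>] (0 : ℝ), 0 < t := eventually_mem_nhdsWithin
  have hlt : ∀ᶠ t in 𝓝[>] (0 : ℝ), t < c := mem_nhdsWithin_of_mem_nhds (Iio_mem_nhds hc)
  obtain ⟨δ, ⟨hδ, hδ0⟩, hδc⟩ := ((hev.and hpos).and hlt).exists
  refine ⟨δ, hδ0, hδc, ?_⟩
  rw [zero_add, smul_eq_mul] at hδ
  have h2 : twoGapFn K c δ - twoGapFn K c 0 < 0 := by
    by_contra hcon
    push Not at hcon
    have : 0 ≤ δ⁻¹ * (twoGapFn K c δ - twoGapFn K c 0) := mul_nonneg (inv_pos.mpr hδ0).le hcon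
    linarith
  linarith

end TwoGap

/-! ## §3 The bumped ladder: the uniform ladder with its rung `1` moved up by `δ` -/

section Bump

/-- `bumpLadder g₀ Λ K δ i = g₀ + Λ·i/K + δ·[i = 1]`: gaps `Λ/K + δ`, `Λ/K − δ`, `Λ/K`, …, same endpoints. [ours] -/
def bumpLadder (g₀ Λ : ℝ) (K : ℕ) (δ : ℝ) (i : ℕ) : ℝ :=
  uniformLadder g₀ Λ K i + if i = 1 then δ else 0

/-- `bumpLadder … 0 = g₀`. [ours] -/
theorem bumpLadder_zero (g₀ Λ : ℝ) (K : ℕ) (δ : ℝ) : bumpLadder g₀ Λ K δ 0 = g₀ := by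
  simp [bumpLadder, uniformLadder_zero]

/-- `bumpLadder … K = g₀ + Λ` (`K ≥ 2`). [ours] -/
theorem bumpLadder_top (g₀ Λ : ℝ) {K : ℕ} (hK : 2 ≤ K) (δ : ℝ) : bumpLadder g₀ Λ K δ K = g₀ + Λ := by
  have hK1 : K ≠ 1 := by omega
  simp [bumpLadder, hK1, uniformLadder_top g₀ Λ (show 0 < K by omega)]

/-- Rung `1` is moved by `δ`. [ours] -/
theorem bumpLadder_apply_one (g₀ Λ : ℝ) (K : ℕ) (δ : ℝ) :
    bumpLadder g₀ Λ K δ 1 = uniformLadder g₀ Λ K 1 + δ := by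
  simp [bumpLadder]

/-- The other rungs are the uniform ladder's. [ours] -/
theorem bumpLadder_apply_of_ne_one (g₀ Λ : ℝ) (K : ℕ) (δ : ℝ) {i : ℕ} (hi : i ≠ 1) :
    bumpLadder g₀ Λ K δ i = uniformLadder g₀ Λ K i := by
  simp [bumpLadder, hi]

/-- Gap `0` is `Λ/K + δ`. [ours] -/
theorem ladderGap_bumpLadder_zero (g₀ Λ : ℝ) (K : ℕ) (δ : ℝ) :
    ladderGap (bumpLadder g₀ Λ K δ) 0 = Λ / K + δ := by
  have h := ladderGap_uniformLadder g₀ Λ K 0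
  unfold ladderGap at h ⊢
  rw [zero_add, bumpLadder_apply_one, bumpLadder_apply_of_ne_one g₀ Λ K δ (by norm_num)]
  rw [zero_add] at h
  linarith

/-- Gap `1` is `Λ/K − δ`. [ours] -/
theorem ladderGap_bumpLadder_one (g₀ Λ : ℝ) (K : ℕ) (δ : ℝ) :
    ladderGap (bumpLadder g₀ Λ K δ) 1 = Λ / K - δ := by
  have h := ladderGap_uniformLadder g₀ Λ K 1
  unfold ladderGap at h ⊢
  rw [bumpLadder_apply_one, bumpLadder_apply_of_ne_one g₀ Λ K δ (by norm_num)]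
  linarith

/-- Gaps `j ≥ 2` are `Λ/K`. [ours] -/
theorem ladderGap_bumpLadder_of_two_le (g₀ Λ : ℝ) (K : ℕ) (δ : ℝ) {j : ℕ} (hj : 2 ≤ j) :
    ladderGap (bumpLadder g₀ Λ K δ) j = Λ / K := by
  have h := ladderGap_uniformLadder g₀ Λ K j
  unfold ladderGap at h ⊢
  rw [bumpLadder_apply_of_ne_one g₀ Λ K δ (show j + 1 ≠ 1 by omega),
    bumpLadder_apply_of_ne_one g₀ Λ K δ (show j ≠ 1 by omega)]
  exact h

/-- Every gap of the bumped ladder is positive when `|δ| < Λ/K`. [ours] -/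
theorem ladderGap_bumpLadder_pos (g₀ : ℝ) {Λ : ℝ} {K : ℕ} {δ : ℝ} (h1 : 0 < Λ / K + δ) (h2 : δ < Λ / K)
    (j : ℕ) : 0 < ladderGap (bumpLadder g₀ Λ K δ) j := by
  rcases Nat.lt_or_ge j 2 with hj | hj
  · interval_cases j
    · rw [ladderGap_bumpLadder_zero]; exact h1
    · rw [ladderGap_bumpLadder_one]; linarith
  · rw [ladderGap_bumpLadder_of_two_le g₀ Λ K δ hj]; linarith

/-- Hence the bumped ladder is strictly increasing (`|δ| < Λ/K`). [ours] -/
theorem strictMono_bumpLadder (g₀ : ℝ) {Λ : ℝ} {K : ℕ} {δ : ℝ} (h1 : 0 < Λ / K + δ) (h2 : δ < Λ / K) :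
    StrictMono (bumpLadder g₀ Λ K δ) :=
  strictMono_nat_of_lt_succ fun j => sub_pos.mp (ladderGap_bumpLadder_pos g₀ h1 h2 j)

/-- **`indexCost(bump) − indexCost(uniform) = twoGapFn K (Λ/K) δ − twoGapFn K (Λ/K) 0`** (`K ≥ 2`): only pairs
`0` and `1` change. [ours] -/
theorem indexCost_bumpLadder_sub (g₀ Λ : ℝ) {K : ℕ} (hK : 2 ≤ K) (δ : ℝ) :
    indexCost K (bumpLadder g₀ Λ K δ) - indexCost K (uniformLadder g₀ Λ K)
      = twoGapFn K (Λ / K) δ - twoGapFn K (Λ / K) 0 := by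
  unfold indexCost
  rw [← sum_sub_distrib]
  obtain ⟨m, rfl⟩ : ∃ m, K = m + 2 := ⟨K - 2, by omega⟩
  rw [sum_range_succ', sum_range_succ']
  have hrest : ∑ j ∈ range m, (passageWeight (m + 2) (j + 1 + 1) ^ 2 * gaussInvAcc (ladderGap (bumpLadder g₀ Λ (m + 2) δ) (j + 1 + 1))
      - passageWeight (m + 2) (j + 1 + 1) ^ 2 * gaussInvAcc (ladderGap (uniformLadder g₀ Λ (m + 2)) (j + 1 + 1))) = 0 := by
    refine sum_eq_zero fun j _ => ?_
    rw [ladderGap_bumpLadder_of_two_le g₀ Λ (m + 2) δ (by omega), ladderGap_uniformLadder, sub_self]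
  rw [hrest, zero_add, ladderGap_bumpLadder_zero, ladderGap_bumpLadder_one, ladderGap_uniformLadder,
    ladderGap_uniformLadder, passageWeight_zero, passageWeight_one]
  unfold twoGapFn
  rw [add_zero, sub_zero]
  push_cast
  ring

/-- **The bumped ladder's round-trip functional is strictly larger** (`δ ≠ 0`, `K ≥ 2`): gap `0` differs from
`Λ/K`, so `K·gaussInvAcc(Λ/K) < Σ_j gaussInvAcc(gap_j)` by strict convexity (`mul_gaussInvAcc_div_lt_sum`). [ours] -/
theorem sum_gaussInvAcc_bumpLadder_gt (g₀ Λ : ℝ) {K : ℕ} (hK : 2 ≤ K) {δ : ℝ} (hδ : δ ≠ 0) :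
    ∑ j ∈ range K, gaussInvAcc (ladderGap (uniformLadder g₀ Λ K) j)
      < ∑ j ∈ range K, gaussInvAcc (ladderGap (bumpLadder g₀ Λ K δ) j) := by
  rw [sum_gaussInvAcc_uniformLadder]
  have hend : (bumpLadder g₀ Λ K δ K - bumpLadder g₀ Λ K δ 0) / K = Λ / K := by
    rw [bumpLadder_top g₀ Λ hK, bumpLadder_zero]; ring
  have h := mul_gaussInvAcc_div_lt_sum (show 0 < K by omega) (bumpLadder g₀ Λ K δ)
    ⟨0, mem_range.mpr (by omega), by rw [hend, ladderGap_bumpLadder_zero]; intro h; apply hδ; linarith⟩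
  rwa [hend] at h

end Bump

/-! ## §4 The equal-acceptance ladder is not `τ_int`-optimal for `K ≥ 3` -/

section Main

/-- **FOR `K ≥ 3` SOME LADDER WITH THE SAME ENDPOINTS HAS A STRICTLY SMALLER `indexCost` AND A STRICTLY LARGER
ROUND-TRIP FUNCTIONAL THAN THE UNIFORM (EQUAL-ACCEPTANCE) LADDER.** [ours] -/
theorem exists_ladder_indexCost_lt_uniform {K : ℕ} (hK : 3 ≤ K) {Λ : ℝ} (hΛ : 0 < Λ) (g₀ : ℝ) :
    ∃ g : ℕ → ℝ, StrictMono g ∧ g 0 = g₀ ∧ g K = g₀ + Λ ∧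
      indexCost K g < indexCost K (uniformLadder g₀ Λ K) ∧
      ∑ j ∈ range K, gaussInvAcc (ladderGap (uniformLadder g₀ Λ K) j)
        < ∑ j ∈ range K, gaussInvAcc (ladderGap g j) := by
  have hK0 : (0 : ℝ) < K := by exact_mod_cast (show 0 < K by omega)
  have hc : 0 < Λ / K := div_pos hΛ hK0
  obtain ⟨δ, hδ0, hδc, hlt⟩ := exists_twoGapFn_lt hK hc
  refine ⟨bumpLadder g₀ Λ K δ, strictMono_bumpLadder g₀ (by linarith) hδc, bumpLadder_zero g₀ Λ K δ,
    bumpLadder_top g₀ Λ (by omega) δ, ?_, sum_gaussInvAcc_bumpLadder_gt g₀ Λ (by omega) hδ0.ne'⟩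
  have h := indexCost_bumpLadder_sub g₀ Λ (show 2 ≤ K by omega) δ
  linarith

variable {K : ℕ}

/-- **THE SAME IN THE WALK VOCABULARY: for `K ≥ 3` there is a strictly increasing ladder `g` with the uniform
ladder's endpoints whose model replica-index `τ_int` (the `asympVar` quotient of `SwapLadderIndexTauInt` for the
profile `ladderProfile g`) is STRICTLY SMALLER than the uniform ladder's, while its model round trip
(`SwapLadderRoundTrip`'s hitting times) is STRICTLY LONGER.**  The equal-acceptance ladder, the unique round-trip
optimum (GEN-6), is therefore not the `τ_int` optimum. [ours] -/
theorem model_index_tauInt_lt_uniform (hK : 3 ≤ K) {Λ : ℝ} (hΛ : 0 < Λ) (g₀ : ℝ) :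
    ∃ g : ℕ → ℝ, StrictMono g ∧ g 0 = g₀ ∧ g K = g₀ + Λ ∧
      (∀ (p q p' q' : ℕ → ℝ), IsRowStochastic (bdKernel K p q) →
        (∀ k, k < K → p k = ladderProfile g k / 2) → p K = 0 → q 0 = 0 →
        (∀ k, 1 ≤ k → k ≤ K → q k = ladderProfile g (k - 1) / 2) →
        IsRowStochastic (bdKernel K p' q') →
        (∀ k, k < K → p' k = ladderProfile (uniformLadder g₀ Λ K) k / 2) → p' K = 0 → q' 0 = 0 →
        (∀ k, 1 ≤ k → k ≤ K → q' k = ladderProfile (uniformLadder g₀ Λ K) (k - 1) / 2) →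
        asympVar (levelObs K) (unifLaw K) (bdKernel K p q)
            / (2 * piInner (unifLaw K) (centred (unifLaw K) (levelObs K)) (centred (unifLaw K) (levelObs K)))
          < asympVar (levelObs K) (unifLaw K) (bdKernel K p' q')
            / (2 * piInner (unifLaw K) (centred (unifLaw K) (levelObs K)) (centred (unifLaw K) (levelObs K)))) ∧
      (∀ (h h' : Fin (K + 1) → Fin (K + 1) → ℝ),
        IsHittingTimeSolution (profileWalk K (ladderProfile g)) h →
        IsHittingTimeSolution (profileWalk K (ladderProfile (uniformLadder g₀ Λ K))) h' →
        h' 0 (Fin.last K) + h' (Fin.last K) 0 < h 0 (Fin.last K) + h (Fin.last K) 0) := by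
  obtain ⟨g, hmono, hg0, hgK, hcost, hrt⟩ := exists_ladder_indexCost_lt_uniform hK hΛ g₀
  have hK1 : 1 ≤ K := by omega
  have hKpos : (0 : ℝ) < 6 / ((K : ℝ) * (K + 1) * (K + 2)) := by
    have : (0 : ℝ) < K := by exact_mod_cast (show 0 < K by omega)
    positivity
  refine ⟨g, hmono, hg0, hgK, ?_, ?_⟩
  · intro p q p' q' hP hp hpK hq0 hq hP' hp' hpK' hq0' hq'
    rw [model_index_tauInt hK1 hP hp hpK hq0 hq, model_index_tauInt hK1 hP' hp' hpK' hq0' hq']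
    have := mul_lt_mul_of_pos_left hcost hKpos
    linarith
  · intro h h' hh hh'
    rw [model_round_trip hmono.monotone hh, model_round_trip (monotone_uniformLadder g₀ hΛ.le K) hh']
    have hK2 : (0 : ℝ) < 2 * ((K : ℝ) + 1) := by positivity
    exact mul_lt_mul_of_pos_left hrt hK2

end Main

/-! ## §5 A universal band between the two model functionals (every ladder, every `K ≥ 1`) -/

section Band

variable {K : ℕ}

/-- `K ≤ w_j` for `j < K` (`(j+1)(K−j) = K + j(K−1−j)`). [ours] -/
theorem le_passageWeight {j : ℕ} (hj : j < K) : (K : ℝ) ≤ passageWeight K j := by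
  unfold passageWeight
  have hj' : (j : ℝ) + 1 ≤ K := by exact_mod_cast hj
  have hj0 : (0 : ℝ) ≤ j := Nat.cast_nonneg j
  nlinarith

/-- `w_j ≤ (K+1)²/4` (`(K+1)² − 4(j+1)(K−j) = (K−2j−1)²`). [ours] -/
theorem passageWeight_le (K j : ℕ) : passageWeight K j ≤ ((K : ℝ) + 1) ^ 2 / 4 := by
  unfold passageWeight
  nlinarith [sq_nonneg ((K : ℝ) - 2 * j - 1)]

/-- **`K²·Σ_j gaussInvAcc(gap_j) ≤ indexCost K g`** — with `model_index_tauInt` and `model_round_trip`: the model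
index `τ_int + 1/2` is at least `3K/((K+1)²(K+2))` model round trips. [ours] -/
theorem sq_mul_sum_le_indexCost (g : ℕ → ℝ) :
    (K : ℝ) ^ 2 * ∑ j ∈ range K, gaussInvAcc (ladderGap g j) ≤ indexCost K g := by
  unfold indexCost
  rw [mul_sum]
  refine sum_le_sum fun j hj => ?_
  have hw := le_passageWeight (K := K) (mem_range.mp hj)
  have hK : (0 : ℝ) ≤ K := Nat.cast_nonneg K
  exact mul_le_mul_of_nonneg_right (pow_le_pow_left₀ hK hw 2) (gaussInvAcc_pos _).le

/-- **`indexCost K g ≤ ((K+1)⁴/16)·Σ_j gaussInvAcc(gap_j)`** — the model index `τ_int + 1/2` is at most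
`3(K+1)²/(16K(K+2))` model round trips (flat ladder: exactly `(K²+2K+2)/(10K(K+1))` of one, `→ 1/10`). [ours] -/
theorem indexCost_le_mul_sum (g : ℕ → ℝ) :
    indexCost K g ≤ ((K : ℝ) + 1) ^ 4 / 16 * ∑ j ∈ range K, gaussInvAcc (ladderGap g j) := by
  unfold indexCost
  rw [mul_sum]
  refine sum_le_sum fun j hj => ?_
  have hw := passageWeight_le K j
  have hw0 : 0 ≤ passageWeight K j := (Nat.cast_nonneg K).trans (le_passageWeight (mem_range.mp hj))
  refine mul_le_mul_of_nonneg_right ?_ (gaussInvAcc_pos _).le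
  calc passageWeight K j ^ 2 ≤ (((K : ℝ) + 1) ^ 2 / 4) ^ 2 := pow_le_pow_left₀ hw0 hw 2
    _ = ((K : ℝ) + 1) ^ 4 / 16 := by ring

/-- The flat ladder inside the band: `indexCost(uniform) = ((K+1)(K+2)(K²+2K+2)/30)·Σ_j gaussInvAcc(gap_j)`
(`Σ_j w_j² = K(K+1)(K+2)(K²+2K+2)/30`, all gaps `Λ/K`). [ours] -/
theorem indexCost_uniformLadder_eq_mul_sum (g₀ Λ : ℝ) (K : ℕ) :
    indexCost K (uniformLadder g₀ Λ K)
      = ((K : ℝ) + 1) * (K + 2) * ((K : ℝ) ^ 2 + 2 * K + 2) / 30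
        * ∑ j ∈ range K, gaussInvAcc (ladderGap (uniformLadder g₀ Λ K) j) := by
  rw [indexCost_uniformLadder, sum_gaussInvAcc_uniformLadder]
  ring

end Band

end Summit.Ventures.LatticeQCDFlow.Scaling

end
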